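import Summits.BirchSwinnertonDyer.BirchSwinnertonDyer.Theses.OneSidedTwistSqueezeX9
import Summits.BirchSwinnertonDyer.BirchSwinnertonDyer.Theorems.OneSidedTwistSqueezeX9KatoDivisibilityX9StubsOfF1
import Summits.BirchSwinnertonDyer.Rank1Residual.SmallImageMu.ConjARoadEdges
import Literature.NumberTheory.EllipticCurves.Rank1Residual.RankOneAnchorData
import HarnessLib

/-!
# `Lines/conj-a-road.lean` — LEAD-OWNED SKELETON (v3) of the deciding crux `KatoDivisibilityX9`
# (stmt-BirchSwinnertonDyer-20547) of route `OneSidedTwistSqueezeX9`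
# (route-BirchSwinnertonDyer-OneSidedTwistSqueezeX9, OPEN, tribunal PASS round 1, tier B)

**v3 (2026-08-28, prover seat `bsd-line-k6-p4`, D-0154 KEY (146) row 9; lineage = the registered BC3 birth
skeleton `Lines/birth.lean` v2, sha256 61050dcd…, planner `-imc` g7).**  What changed against v2: the two
registered stubs that have LANDED in the tree (p571670,
`Theorems/OneSidedTwistSqueezeX9KatoDivisibilityX9StubsOfF1.lean`) — `stub_wuthrichUpgradeX9` and
`stub_fmwRungX9` — are no longer `sorry`s here but one-line references to the landed theorems (same names,
same registered signatures).  Sorries: 4 → 2.  OPEN: `stub_katoPackageF1` (F1 — a cite-only PRINT INPUT,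
Kato 2004; implied by the verbatim-composite restatement F1′
`Kato2004.exists_divisibilityInputsZetaLine_fineQuotient_zeta` via
`exists_divisibilityInputs_fineQuotient_zeta_of_zetaLine` + `SmallImageMu.fineQuotient_of_zeta`; not a prover
target) and `stub_conjAOnClassX9` (Coates–Sujatha Conjecture A at every X9 pair — OPEN-PROBLEM grade, the
whole mathematical content of the crux on this line; in-tree roads into it: `ConjARoadEdges.lean` K1 / K1′ /
ES-C2 / CS-A and `conjAOnClassX9_of_analyticMuZeroX9` = item 19630 ∧ F1_ζ ∧ modularity).  The v2 text of the
birth skeleton follows unchanged below this paragraph.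

Cell `bsd-f3-mu` (HOME `run/shared/lean/pub/bsd-f3-mu/`), planner of record `-imc` gen 6, on director-bsd
g10 W-25 (2026-08-27T18:46:48Z) and the tribunal J's designate (verdict-OneSidedTwistSqueezeX9-bsd-trib-j-1:
«ACCEPTABLE AS PLAN-ONLY the moment the cell registers `stub_wuthrichUpgradeX9 : ConjAOnClassX9 →
KatoDivisibilityX9` (the (m3) line) as a named stub»).  LINE (m3) «Conjecture-A road», stated over TREE
declarations only (no local `def`s): the two W-25 stubs, the kernel-checked composition `KatoDivisibilityX9_of`
concluding the crux BY NAME (the ROUTE decl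
`Summit.BirchSwinnertonDyer.BirchSwinnertonDyer.Theses.OneSidedTwistSqueezeX9.KatoDivisibilityX9`, which is the
tree node `Summit.BirchSwinnertonDyer.Rank1Residual.SmallImageMu.KatoDivisibilityOnClassX9` by `rfl`), plus two
finer registered stubs that cut stub 2 along the landed edges and name the BC5 rung by its exact signature.
Sorries ONLY inside `stub_*`.

* `stub_conjAOnClassX9 : SmallImageMu.ConjAOnClassX9` — Coates–Sujatha Conjecture A at every X9 pair over
  `ℚ^{cyc}` (tree node, `@[conjecture]`, nothing asserted; OPEN class-wide — one storey above Ferrero–Washington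
  for the torsion-point fields of degree 8 / 12 / 24; certified PER PAIR by rank-one anchor data:
  `FineSelmerControl.conjA_rat_of_rankOne`, landed).  HARDEST stub (open-problem grade).
* `stub_wuthrichUpgradeX9 : SmallImageMu.ConjAOnClassX9 → KatoDivisibilityX9` — Wuthrich's upgrade «Conj A ⟹
  Kato's one-sided divisibility», IMAGE-FREE on X9 (Wuthrich 2006 Thm 2 / Lemma 3 mechanism `char Y ∣ pᵗ·ind,
  p ∤ char Y ⟹ t = 0`, re-run with Kato §17.13 at the height-one prime `(p)`).  SIZE: M modulo print — it
  FACTORS (theorem `wuthrichUpgradeX9_of_muDefectLeFineMuOnClassX9` below, kernel, no sorry) through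
  `stub_muDefectLeFineMuOnClassX9` (S-W⁺ on X9: `k ≤ μ(X₀)`) and the three PUBLISHED named facts BCS 2025
  Thm 1.1.2 (a), BCDT modularity, Kato's §13–§17 package with the fine quotient (F1-fine), via the landed edge
  `SmallImageMu.katoDivisibilityOnClassX9_of_conjAOnClassX9'` (T0 `μ(X₀) = 0 ⟸ Conj A` is the landed carrier
  theorem `Rank1Residual.ConjAAt.fineMuZeroAt`).  This stub is the tribunal's T3 PLAN-ONLY witness.
* `stub_muDefectLeFineMuOnClassX9` — S-W⁺ at every X9 pair (`Rank1Residual.MuDefectLeFineMuAt`, the `-desc`/`-es`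
  carrier: `k ≤ μ(Y)`; paper proof Kato §17.13 keeping the `(Λ/(G₁))_(p)` term; HOME/es/EulerLossChart.lean is a
  0-sorry model over an abstract exact sequence; tree landing in progress: `SmallImageMu/KatoFineSelmerDualGraded`
  (p557296, landed), `SmallImageMu/GradedEulerLossCore` (p559174, review)).  SIZE M.
* `stub_fmwRungX9` — the BC5 RUNG by exact signature: at an X9 pair CARRYING RANK-ONE ANCHOR DATA
  (`Rank1Residual.RankOneAnchorDataAt`, Literature predicate, p556419 landed) and S-W⁺ at the pair, Kato's
  INTEGRAL one-sided divisibility `KatoDivisibilityAt W p` holds, modulo the three published facts.  PROVED in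
  HOME/imc/g4/OneSidedTwistSqueezeX9FMWRung.landing.lean (sha16 2a4f5150bddaa2bb, rc 0, 0 sorry;
  `SmallImageMu.katoDivisibilityAt_of_rankOneAnchorData`) — awaiting a prover's `--supports
  stmt-BirchSwinnertonDyer-20547` landing, which discharges THIS stub by name + signature.  Census: 234 / 415
  rank-1 X9 records carry the data (HOME/desc/d10/FMW-CERT-v2.tsv 9ca5fa31d4fdb843); instance `648a1 @ p = 5`
  (image 5S4) lies outside every printed case of BSD_p / IMC_p (no multiplicative prime; (im) fails on X9 by
  `Rank1Residual.not_bcsHypothesisIm_of_classX9`).  SIZE S (kernel plumbing over landed theorems).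

Disproof used: none relevant (no `Disproof.lean` on this crux; `ledger negatives --problem BirchSwinnertonDyer`:
the X9 negatives TamePinch stmt-15532 and HorizontalIndivisibilityOnClassX9 163/790 are not instances of any stub —
nothing here quantifies `∃ p` over curves or asserts Heegner indivisibility).

References: [CoatesSujatha2005] §3 Conjecture A, Thm 3.4; [Wuthrich2006] Thm 2, Lemma 3, Prop 7 (p. 717);
[Kato2004Asterisque] Thm 12.5, Thm 17.4, §17.13 (pp. 279–280); [BurungaleCastellaSkinner2025] Thm 1.1.2 (a),
display (5.3) (p. 10 of arXiv:2405.00270v2); [GreenbergLNM1716] Prop 3.8; HOME/MEMO-imc.md §12–§13,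
HOME/imc/lines/conj-a-road-fine.lean (the earlier five-stub cut, evidence #2/#7 on the item).
-/

set_option autoImplicit false

-- the summit and its single problem are both named `BirchSwinnertonDyer` (registry layout D-0017)
set_option linter.dupNamespace false

noncomputable section

open WeierstrassCurve Literature.NumberTheory.EllipticCurves Literature.NumberTheory.EllipticCurves.ModularForms
  Summit.BirchSwinnertonDyer.BirchSwinnertonDyer.Rank1Residual
open Literature.NumberTheory.EllipticCurves.Rank1Residual (RankOneAnchorDataAt KatoDivisibilityAt MuDefectLeFineMuAt
  ConjAAt)
open Summit.BirchSwinnertonDyer.Rank1Residual.SmallImageMu (ConjAOnClassX9 KatoDivisibilityOnClassX9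
  katoDivisibilityOnClassX9_of_conjAOnClassX9' katoDivisibilityOnClassX9_iff)
open Summit.BirchSwinnertonDyer.BirchSwinnertonDyer.Theses.OneSidedTwistSqueezeX9 (KatoDivisibilityX9)

-- **v2 (2026-08-27T20:50Z, -imc g7, executing -es g7 TURNKEY (μ))**: stub 0 `stub_katoPackageF1` (F1, cite-only) added;
-- stubs 2 and 4 re-signed with the F1 antecedent ONLY (no BCS (a), no modular parametrisation, no S-W⁺ binder) — both are
-- THEOREMS in -es's landing twin (`wuthrichUpgradeX9_of_fineQuotient`, `katoDivisibilityAt_of_rankOneAnchorData_F1`); v1 stub 3 dropped.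
namespace Summit.BirchSwinnertonDyer.BirchSwinnertonDyer.Cruxes.KatoDivisibilityX9.Birth

/-! ## The registered stubs -/

/-- **stub 0 · `katoPackageF1` — the ONE cite-only print input of LINE A (v2 re-cut, -es g7 TURNKEY (μ)):** Kato's
Euler-system package with the fine quotient (Kato 2004, Astérisque 295, Thm 12.5 + §13 + §17.13), typed as the named fact
`Kato2004.exists_divisibilityInputs_fineQuotient` (a `def : Prop`, statement-only; NOT a conjunct of the route's support item
`PublishedInputsX9`).  Like LINE B's `stub_vasersteinAway` it is closable only by a PORT of the proof or displayed by an `…OfInputs`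
re-glue of the route (coordinator's call, -es 20:36:04Z (b)); it is the only print residue between «Conjecture A on X9» and the crux.
[cite: Kato2004Asterisque, Thm. 12.5, §13, §17.13 (pp. 279–280)] -/
theorem stub_katoPackageF1 : Kato2004.exists_divisibilityInputs_fineQuotient := by
  sorry

/-- STUB 1 (HARDEST; open-problem grade): Coates–Sujatha Conjecture A at every X9 pair over `ℚ^{cyc}`
(tree node `SmallImageMu.ConjAOnClassX9`). [cite: CoatesSujatha2005, §3 Conjecture A — OPEN] -/
theorem stub_conjAOnClassX9 : ConjAOnClassX9 := by
  sorry

/-- STUB 2 (T3 PLAN-ONLY witness by name; size M modulo print — see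
`wuthrichUpgradeX9_of_muDefectLeFineMuOnClassX9`): Conjecture A on X9 ⟹ the crux, image-free.
[cite: Wuthrich2006, Thm. 2 and Lemma 3 (p. 717)] [cite: Kato2004Asterisque, §17.13 (pp. 279–280)] -/
theorem stub_wuthrichUpgradeX9 :
    Kato2004.exists_divisibilityInputs_fineQuotient → ConjAOnClassX9 → KatoDivisibilityX9 :=
  -- LANDED (p571670): `…Theorems.OneSidedTwistSqueezeX9KatoDivisibilityX9Stubs.stub_wuthrichUpgradeX9`
  Summit.BirchSwinnertonDyer.BirchSwinnertonDyer.Theorems.OneSidedTwistSqueezeX9KatoDivisibilityX9Stubs.stub_wuthrichUpgradeX9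

-- (v1 stub 3 `stub_muDefectLeFineMuOnClassX9` — S-W⁺ on X9 — DROPPED in v2: it is a THEOREM modulo F1,
-- `SmallImageMu.muDefectLeFineMuOnClassX9_of_fineQuotient` (-es g7 MuDefectLeFineMu.landing.lean 9f00d421f3c999e6, TURNKEY (λ) [-ty]),
-- and stub 2 no longer consumes it.)

/-- STUB 4 (size S; the BC5 RUNG by exact signature — PROVED in HOME/imc/g4/OneSidedTwistSqueezeX9FMWRung.landing.lean
as `SmallImageMu.katoDivisibilityAt_of_rankOneAnchorData`, awaiting its `--supports` landing): at an X9 pair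
carrying rank-one anchor data and S-W⁺, Kato's integral one-sided divisibility holds, modulo BCS (a), BCDT and
F1-fine. [cite: GreenbergLNM1716, Prop. 3.8 (pp. 95–96)] [cite: Kato2004Asterisque, Thm. 17.4 (p. 273) and §17.13] -/
theorem stub_fmwRungX9 :
    Kato2004.exists_divisibilityInputs_fineQuotient →
    ∀ (W : WeierstrassCurve ℚ) [W.IsElliptic] [W.IsGloballyMinimal] (p : ℕ) [Fact p.Prime],
      ClassX9 W p → RankOneAnchorDataAt W p → KatoDivisibilityAt W p :=
  -- LANDED (p571670): `…Theorems.OneSidedTwistSqueezeX9KatoDivisibilityX9Stubs.stub_fmwRungX9`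
  Summit.BirchSwinnertonDyer.BirchSwinnertonDyer.Theorems.OneSidedTwistSqueezeX9KatoDivisibilityX9Stubs.stub_fmwRungX9

/-! ## Kernel-checked compositions (no sorry outside the stubs they name)

Audit shape (HarnessLib `#h21_check_skeleton`, A12): the theorems concluding the crux BY NAME take no `Prop` hypothesis
other than registered obligations (here: the `@[conjecture]` tree node `SmallImageMu.ConjAOnClassX9`); every other
composition concludes the TREE NODE `SmallImageMu.KatoDivisibilityOnClassX9`, to which the route decl reduces by `rfl`. -/

/-- The route decl IS the tree node (so every node-concluding theorem below is a statement about the crux). -/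
example : KatoDivisibilityX9 = KatoDivisibilityOnClassX9 := rfl

/-- **Composition (v2, kernel-checked; the only `sorry`s are inside the registered `stub_*` obligations, invoked BY NAME):**
stub 0 (F1, cite-only) → stub 1 (Conjecture A on X9, OPEN) → stub 2 (PROVED modulo F1: `wuthrichUpgradeX9_of_fineQuotient`) →
the ROUTE decl `KatoDivisibilityX9` by name.  Stub 4 (the FMW rung = BC5 witness regime) is a RESTRICTION of the crux and is
shown below to follow from the node. [folklore] -/
theorem KatoDivisibilityX9_of : KatoDivisibilityX9 :=
  stub_wuthrichUpgradeX9 stub_katoPackageF1 stub_conjAOnClassX9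

/-- **Stub 4 modulo the node** (kernel): the rung's statement follows from the node at every X9 pair, anchored or not.
[folklore] -/
theorem fmwRung_of_katoDivisibilityOnClassX9 (h : KatoDivisibilityOnClassX9) :
    Kato2004.exists_divisibilityInputs_fineQuotient →
    ∀ (W : WeierstrassCurve ℚ) [W.IsElliptic] [W.IsGloballyMinimal] (p : ℕ) [Fact p.Prime],
      ClassX9 W p → RankOneAnchorDataAt W p → KatoDivisibilityAt W p :=
  fun _ W _ _ p _ hX9 _ => (katoDivisibilityOnClassX9_iff.mp h) W p hX9

end Summit.BirchSwinnertonDyer.BirchSwinnertonDyer.Cruxes.KatoDivisibilityX9.Birth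

end
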